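import Summits.MatrixMultiplication.OmegaCensus.STPPCell22Sound1
import Summits.MatrixMultiplication.OmegaCensus.STPPCell22Sound2

/-!
# ω-census (abelian STPP census): cell-(2,2) certificate soundness, part 4 — row eliminations and two more meaning lemmas (tool file)

HONEST FRAMING (pub-omega census; verbatim): lottery ticket; floor = certified bounds/negative ranges.
Census STRUCTURE (seat pub-omega-stpp-1 gen 33, 2026-08-29), family (b2).  For the law consuming the cell-(2,2) rows (plan HOME
`pub-omega-stpp-1-g33/FIFTH-LEAF.md` §SOUNDNESS, steps S4–S8): what one row of each stage gives at a point (`nrmListed`, the normalisation /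
shape-coverage rows, `place22Row`, `real22`), the meaning of `s1Mask`, and dilation commutes with rotation (`dilMask_rot`).
UNCONDITIONAL; no `decide`.  Nothing here is progress on `ω`.

References: H. S. Warren, Hacker's Delight (2002), §2-1 (bit sets); H. Cohn, R. Kleinberg, B. Szegedy, C. Umans, FOCS 2005, Def. 5.1 (the use).
-/

namespace Summit.MatrixMultiplication.OmegaCensus.CubeNB.S2

open Summit.MatrixMultiplication.OmegaCensus.CubeNB.Bits

/-! ## §1 Row eliminations -/

/-- What `nrmListed` records. [folklore] -/
theorem mem_of_nrmListed {p : ℕ} {nz : List (ℕ × ℕ × ℕ × ℕ)} {e : ℕ × ℕ} (h : nrmListed p nz e = true) :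
    (e.1, e.2, nrmMask p (s1Mask p e.1 e.2), offMask p (nrmMask p (s1Mask p e.1 e.2)) (s1Mask p e.1 e.2)) ∈ nz := by
  unfold nrmListed at h
  simpa using h

/-- The normalisation row at one zoo entry with `y ∈ {2,3,4}`. [folklore] -/
theorem nrmListed_of_row {p : ℕ} {zoo : List (ℕ × ℕ)} {nz : List (ℕ × ℕ × ℕ × ℕ)}
    (h : (zoo.all fun e => !([2, 3, 4].elem e.1) || nrmListed p nz e) = true) {e : ℕ × ℕ} (he : e ∈ zoo) (hy : e.1 = 2 ∨ e.1 = 3 ∨ e.1 = 4) :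
    nrmListed p nz e = true := by
  rw [List.all_eq_true] at h
  have h1 := h e he
  rw [Bool.or_eq_true] at h1
  rcases h1 with h1 | h1
  · exfalso
    have hmem : [2, 3, 4].elem e.1 = true := by
      rw [List.elem_eq_mem, decide_eq_true_eq]; simp only [List.mem_cons, List.not_mem_nil, or_false]; omega
    rw [hmem] at h1
    exact Bool.false_ne_true (by simpa using h1.symm)
  · exact h1

/-- The shape-coverage row at one normalised entry. [folklore] -/
theorem mem_shp_of_row {nz : List (ℕ × ℕ × ℕ × ℕ)} {shp : List (ℕ × ℕ)} (h : (nz.all fun r => decide ((r.1, r.2.2.1) ∈ shp)) = true)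
    {r : ℕ × ℕ × ℕ × ℕ} (hr : r ∈ nz) : (r.1, r.2.2.1) ∈ shp := by
  rw [List.all_eq_true] at h
  simpa using h r hr

/-- The stage-1 row at one shape `a`. [folklore] -/
theorem place22_of_row {p : ℕ} {shp : List (ℕ × ℕ)} {plc : List (ℕ × ℕ × ℕ × ℕ × ℕ × ℕ)} {b : ℕ × ℕ} {w : ℕ}
    (h : place22Row p shp plc b w = true) {a : ℕ × ℕ} (ha : a ∈ shp) :
    place22 p plc a.1 a.2 b.1 b.2 w (dilMask p b.2 w) (members (List.range p) (dilMask p b.2 w)) = true := by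
  unfold place22Row at h
  rw [List.all_eq_true] at h
  exact h a ha

/-- The stage-2 row at one placement and one pair of normalised entries. [folklore] -/
theorem lookup22_of_real22 {p : ℕ} {nz : List (ℕ × ℕ × ℕ × ℕ)} {tbl : List (ℕ × List ℕ)} {y σ₁ y' σ₂ w s₁ : ℕ}
    (h : real22 p nz tbl (y, σ₁, y', σ₂, w, s₁) = true) {m₁ t₁ m₂ t₂ : ℕ} (h₁ : (y, m₁, σ₁, t₁) ∈ nz) (h₂ : (y', m₂, σ₂, t₂) ∈ nz) :
    lookup22 tbl m₁ (rot p (dilMask p m₂ w) ((s₁ + t₁ + p * p - w * t₂) % p)) = true := by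
  unfold real22 at h
  simp only [List.all_eq_true] at h
  have h1 := h _ h₁
  simp only [Nat.beq_refl, Bool.and_self, Bool.not_true, Bool.false_or, List.all_eq_true] at h1
  have h2 := h1 _ h₂
  simpa using h2

/-! ## §2 Meaning of `s1Mask`; dilation commutes with rotation -/

/-- `s1Mask` is a mask below `2^p`. [folklore] -/
theorem s1Mask_lt_two_pow {p y m : ℕ} (hm : m < 2 ^ p) : s1Mask p y m < 2 ^ p :=
  Nat.or_lt_two_pow (Nat.or_lt_two_pow hm (rot_lt_two_pow _ _ _)) (rot_lt_two_pow _ _ _)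

/-- **Meaning of `s1Mask`**: `v ∈ {0,1,y} + set m` iff `v`, `v − 1` or `v − y` is a member of `m`. [folklore] -/
theorem tb_s1Mask {p y m v : ℕ} (hm : m < 2 ^ p) (h1 : 1 ≤ p) (hy : y ≤ p) (hv : v < p) :
    tb (s1Mask p y m) v = true ↔ tb m v = true ∨ tb m ((v + p - 1) % p) = true ∨ tb m ((v + p - y) % p) = true := by
  rw [s1Mask, tb_lor, tb_lor, Bool.or_eq_true, Bool.or_eq_true, tb_rot hm h1 hv, tb_rot hm hy hv, or_assoc]

/-- **Dilation commutes with rotation**: `w·(σ + t) = w·σ + w t`. [folklore] -/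
theorem dilMask_rot {p σ t w : ℕ} (hp : 0 < p) (hσ : σ < 2 ^ p) (ht : t ≤ p) :
    dilMask p (rot p σ t) w = rot p (dilMask p σ w) (w * t % p) := by
  refine eq_of_tb_eq (dilMask_lt_two_pow hp) (rot_lt_two_pow _ _ _) fun v hv => ?_
  rw [Bool.eq_iff_iff, tb_dilMask, tb_rot (dilMask_lt_two_pow hp) (Nat.mod_lt _ hp).le hv, tb_dilMask]
  constructor
  · rintro ⟨x, hxp, hx, rfl⟩
    rw [tb_rot hσ ht hxp] at hx
    refine ⟨(x + p - t) % p, Nat.mod_lt _ hp, hx, ?_⟩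
    -- `(x − t)·w ≡ x w − w t`
    have key : ((x + p - t) % p * w) % p = ((x * w % p + p - w * t % p) % p) % p := by
      refine (ZMod.natCast_eq_natCast_iff' _ _ p).1 ?_
      have h1 : t ≤ x + p := by omega
      have h2 : w * t % p ≤ x * w % p + p := by have := Nat.mod_lt (w * t) hp; omega
      rw [Nat.cast_mul, ZMod.natCast_mod, Nat.cast_sub h1, ZMod.natCast_mod, Nat.cast_sub h2]
      push_cast
      rw [ZMod.natCast_mod, ZMod.natCast_mod, ZMod.natCast_self]
      push_cast
      ring
    rwa [Nat.mod_eq_of_lt (Nat.mod_lt _ hp)] at key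
  · rintro ⟨x', hx'p, hx', hx'v⟩
    refine ⟨(x' + t) % p, Nat.mod_lt _ hp, ?_, ?_⟩
    · rw [tb_rot hσ ht (Nat.mod_lt _ hp), mod_add_sub_cancel hx'p ht]; exact hx'
    · -- `(x′ + t)·w ≡ x′ w + w t ≡ (v − w t) + w t = v`
      have key : ((x' + t) % p * w) % p = v % p := by
        refine (ZMod.natCast_eq_natCast_iff' _ _ p).1 ?_
        have h2 : w * t % p ≤ v + p := by have := Nat.mod_lt (w * t) hp; omega
        have hv' : ((x' * w % p : ℕ) : ZMod p) = (((v + p - w * t % p) % p : ℕ) : ZMod p) := by rw [hx'v]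
        rw [ZMod.natCast_mod, ZMod.natCast_mod, Nat.cast_sub h2] at hv'
        push_cast at hv' ⊢
        rw [ZMod.natCast_mod] at hv'
        rw [ZMod.natCast_mod]
        push_cast at hv' ⊢
        rw [ZMod.natCast_self] at hv'
        linear_combination hv'
      rwa [Nat.mod_eq_of_lt hv] at key

end Summit.MatrixMultiplication.OmegaCensus.CubeNB.S2
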